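import Summits.QuantumAdvantage.QuantumAdvantage.Theorems.MobiusLadderLiouvilleOrthogonalTC0SensLtf
import HarnessLib

/-!
# Crux `MobiusLadder.LiouvilleOrthogonalTC0` (stmt-QuantumAdvantage-1393), line `Sketch`, skeleton v6:
# stub `stub_orLtf_translate` — block translates of an `OR` of threshold tests are `OR`s of unate functions

For integer linear threshold tests `L_a(x) = [t_a ≤ Σ_i w_{a,i} x_i]` (`a < K`) of `n` Boolean
variables, a partition `π : Fin n → Fin m` of the variables into `m` blocks and a base point `x`,
each block translate `σ ↦ L_a(x ⊕ π^*σ)` (bit `i` of the argument is `x_i ⊕ σ_{π i}`) is again a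
linear threshold function `[Θ_a ≤ Σ_l W_{a,l} σ_l]` of `σ ∈ {0,1}^m`, now with real weights
(`LtfCore.decide_intLtf_eq` to read the integer test over `ℝ`, then `StubPeresTail.ltf_translate`).
A real threshold function is unate: with the orientation `o_{a,l} = [0 ≤ W_{a,l}]`, moving `σ_l` from
`¬ o_{a,l}` to `o_{a,l}` replaces the summand `W_{a,l} [σ_l]` by `max (W_{a,l}) 0`, so it can only
switch the test on (`StubOrLtfTranslate.ltf_unate`). Packaging the translated tests `f a` with their
orientations `o a` gives the registered stub, consumed by Kane's bound `stub_kaneSens` (D. M. Kane,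
*The average sensitivity of an intersection of half spaces*, 2014) in the depth-two rung of the line.
-/

set_option linter.dupNamespace false -- D-0017: single-problem summit ⇒ `QuantumAdvantage.QuantumAdvantage` by design

noncomputable section

namespace Summit.QuantumAdvantage.QuantumAdvantage.Theorems.LiouvilleOrthogonalTC0

open Finset

namespace StubOrLtfTranslate

variable {m : ℕ}

/-- Splitting the linear form `Σ_l W_l [τ_l]` at the updated coordinate `j`:
`Σ_l W_l [(σ[j ↦ c])_l] = W_j [c] + Σ_{l ≠ j} W_l [σ_l]`. -/
theorem sum_update (W : Fin m → ℝ) (σ : Fin m → Bool) (j : Fin m) (c : Bool) :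
    ∑ l, W l * (if Function.update σ j c l then (1 : ℝ) else 0) =
      W j * (if c then (1 : ℝ) else 0) + ∑ l ∈ univ.erase j, W l * (if σ l then (1 : ℝ) else 0) := by
  rw [← Finset.add_sum_erase _ _ (mem_univ j), Function.update_self]
  congr 1
  refine Finset.sum_congr rfl fun l hl => ?_
  rw [Function.update_of_ne (Finset.ne_of_mem_erase hl)]

/-- The summand `W_j [c]` is maximised at the orientation `c = [0 ≤ W_j]` (where it equals
`max W_j 0`). -/
theorem mul_ite_le (a : ℝ) (c : Bool) :
    a * (if c then (1 : ℝ) else 0) ≤ a * (if decide (0 ≤ a) then (1 : ℝ) else 0) := by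
  by_cases ha : 0 ≤ a
  · rw [decide_eq_true ha]
    cases c
    · simpa using ha
    · simp
  · rw [decide_eq_false ha]
    cases c
    · simp
    · simpa using le_of_lt (not_le.mp ha)

/-- **A real linear threshold function is unate.** For `g(σ) = [Θ ≤ Σ_l W_l σ_l]` and the
orientation `o_j = [0 ≤ W_j]`: if `g(σ[j ↦ ¬ o_j])` holds then so does `g(σ[j ↦ o_j])`. -/
theorem ltf_unate (W : Fin m → ℝ) (Θ : ℝ) (σ : Fin m → Bool) (j : Fin m)
    (h : decide (Θ ≤ ∑ l, W l *
        (if Function.update σ j (!decide (0 ≤ W j)) l then (1 : ℝ) else 0)) = true) :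
    decide (Θ ≤ ∑ l, W l *
        (if Function.update σ j (decide (0 ≤ W j)) l then (1 : ℝ) else 0)) = true := by
  have h' := of_decide_eq_true h
  rw [sum_update] at h'
  refine decide_eq_true ?_
  rw [sum_update]
  exact h'.trans (add_le_add (mul_ite_le (W j) _) le_rfl)

end StubOrLtfTranslate

open StubOrLtfTranslate in
/-- **Stub `stub_orLtf_translate` (line `Sketch`, v6) — block translates of an `OR` of threshold
tests are `OR`s of unate functions.** For integer tests `L_a(x) = [t_a ≤ Σ_i w_{a,i} x_i]`, a
partition `π : [n] → [m]` and a base point `x`, each translate `σ ↦ L_a(x ⊕ π^*σ)` is a real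
threshold function `f_a(σ) = [Θ_a ≤ Σ_l W_{a,l} σ_l]` of `σ ∈ {0,1}^m` (`StubPeresTail.ltf_translate`),
hence unate with orientation `o_{a,l} = [0 ≤ W_{a,l}]` (`StubOrLtfTranslate.ltf_unate`), and the
`OR` over `a` of the integer tests is the `OR` of the `f_a`. -/
theorem stub_orLtf_translate {n m K : ℕ} (w : Fin K → Fin n → ℤ) (t : Fin K → ℤ)
    (π : Fin n → Fin m) (x : Fin n → Bool) :
    ∃ (f : Fin K → (Fin m → Bool) → Bool) (o : Fin K → Fin m → Bool),
      (∀ (a : Fin K) (σ : Fin m → Bool) (j : Fin m),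
        f a (Function.update σ j (!o a j)) = true → f a (Function.update σ j (o a j)) = true) ∧
      ∀ σ : Fin m → Bool,
        decide (∃ a : Fin K, t a ≤ ∑ i, w a i * (if xor (x i) (σ (π i)) then (1 : ℤ) else 0)) =
          decide (∃ a : Fin K, f a σ = true) := by
  choose W Θ hWΘ using fun a : Fin K =>
    StubPeresTail.ltf_translate (fun i => ((w a i : ℤ) : ℝ)) ((t a : ℤ) : ℝ) π x
  refine ⟨fun a σ => decide (Θ a ≤ ∑ l, W a l * (if σ l then (1 : ℝ) else 0)),
    fun a l => decide (0 ≤ W a l), fun a σ j h => ltf_unate (W a) (Θ a) σ j h, fun σ => ?_⟩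
  refine decide_eq_decide.mpr (exists_congr fun a => ?_)
  have h : decide (t a ≤ ∑ i, w a i * (if xor (x i) (σ (π i)) then (1 : ℤ) else 0)) =
      decide (Θ a ≤ ∑ l, W a l * (if σ l then (1 : ℝ) else 0)) :=
    (LtfCore.decide_intLtf_eq (w a) (t a) (fun i => xor (x i) (σ (π i)))).trans
      (congrFun (hWΘ a) σ)
  exact ⟨fun hp => h.symm.trans (decide_eq_true hp), fun hq => of_decide_eq_true (h.trans hq)⟩

end Summit.QuantumAdvantage.QuantumAdvantage.Theorems.LiouvilleOrthogonalTC0
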